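import Summits.CriticalPhenomena.PercolationContinuityZ3.Theorems.PercNearOneGluingNoHeavyConstsFibrewiseBHK
import HarnessLib

/-!
# "Hard-core Harris" at measure level with ONE hard-core vertex — PROVED (PAPER-2 track (ii), hard-core reduction of
# the fibrewise van den Berg–Häggström–Kahn conjecture)

builds on p205010 (kernel theorem, internal audit signed; external expert review pending).  Support file (`--supports
stmt-CriticalPhenomena-4575`), lead seat `prim-nh-lead-4575` (gen 105); memo `run/shared/lean/prim/prim-nh-lead-4575/LEAD-GEN105.md` §1(6).
Theorems only; no sorries; standard axioms.

CONTEXT.  The lead's gen-105 conjecture (HC) "hard-core Harris" (typed fibrewise as `Consts.HardCoreBHK`, proposal p328208; it implies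
`Consts.FibrewiseBHK` = PA-BERN by the reduction theorem of that file's docstring) reads, for a source set `S`, a hard-core vertex set
`N`, increasing cluster predicates `P, Q` and the two copies `(η₀, η₁)` of a two-copy fibre with union clusters `C₀, C₁`:
`#{HC_N, P(C₀), Q(C₁)} ≤ #{HC_N, P(C₀), Q(C₀)}`, `HC_N` = "no vertex of `N` is joined to `S` in both copies".  Summed over all fibres
with the Bernstein weights of ONE weight vector `w` (Linusson's principle) this becomes a statement about two INDEPENDENT copies
`ω₀, ω₁ ~ μ = prodBernoulli w`:  `E[1_{HC_N} 1_P(C₀) 1_Q(C₁)] ≤ E[1_{HC_N} 1_P(C₀) 1_Q(C₀)]`.  For a single hard-core vertex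
`N = {v}`, with `U = {S ↔ v}`, `A = {P(C_S)}`, `B = {Q(C_S)}`, `1_{HC} = 1 − 1_U(ω₀) 1_U(ω₁)` and independence give the
MEASURE-LEVEL form
`μ(A)·μ(B) − μ(A ∩ U)·μ(B ∩ U) ≤ μ(A ∩ B) − μ(A ∩ B ∩ U)·μ(U)`,
i.e. `Cov(A,B) ≥ μ(U)²·Cov(A,B | U)`: conditioning two increasing cluster events on the increasing connection event `{S ↔ v}`
raises their covariance by at most the factor `μ(U)⁻²`.

* `Consts.hardCoreHarris_measure_one` — **THEOREM (this file): the displayed inequality, for every finite vertex type, all weights,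
  every source set `S`, vertex `v` and increasing `P, Q`.**  Proof (law of total covariance over `{U, Uᶜ}`): with `R = Uᶜ = {S ↮ v}`,
  BHK's Theorem 1.3 with sets (tree: `setClusterEventExchange` at `T = {v}`) gives `μ(A∩B∩R)·μ(R) ≥ μ(A∩R)·μ(B∩R)`; Harris
  (`prodBernoulli_harris_via_fibres`) gives `μ(A∩B) ≥ μ(A)μ(B)` and `μ(A∩U) ≥ μ(A)μ(U)`, `μ(B∩U) ≥ μ(B)μ(U)`; then either
  `μ(A∩B∩U)μ(U) ≤ μ(A∩U)μ(B∩U)` and the claim follows from Harris alone, or the polynomial identity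
  `r·u·Φ = (r·a_U − u·a_R)(r·b_U − u·b_R) + r²(u·y − a_U b_U) + u(r·x − a_R b_R)` (`Φ` = RHS − LHS, `r = μ(R)`, `u = μ(U)`,
  `a_U = μ(A∩U)`, `a_R = μ(A∩R)`, `x = μ(A∩B∩R)`, `y = μ(A∩B∩U)`) exhibits `r·u·Φ` as a sum of nonnegative terms.
  This is the `|N| = 1` case of the measure-level identity `E[1_{HC_N}·1_A(ω₀)(1_B(ω₀) − 1_B(ω₁))] = Σ_{W ⊆ N} (−1)^{|W|} μ(U_W)² Cov(A,B | U_W)`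
  (`U_W = {S ↔ every w ∈ W}`), whose nonnegativity for `|N| ≥ 2` is open (memo §1(6)); the FIBREWISE statement `Consts.HardCoreBHK`
  is open for every `N ≠ ∅`.
[cite: VandenbergHaggstromKahn2005, Thm. 1.3 (p. 6) with Remark 1 after Thm. 1.2 (p. 5)] [cite: Harris1960, Lemma 4.1] [cite: Linusson2011, Prop. 2.6]
-/

noncomputable section

namespace Summit.CriticalPhenomena.PercolationContinuityZ3.Theorems

open MeasureTheory Set Literature.Probability.LatticeModels Literature.Probability.Percolation
open scoped Classical

namespace Consts

variable {V : Type*} [Fintype V]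

/-- The real-arithmetic core of `hardCoreHarris_measure_one` (law of total covariance over the two blocks `U`, `R = Uᶜ`):
from the block decompositions, BHK on the block `R` (`aR·bR ≤ x·r`), Harris (`a·b ≤ ab`, `a·u ≤ aU`, `b·u ≤ bU`) and the
trivial bounds, `a·b − aU·bU ≤ ab − y·u`.  Key identity: `r·u·Φ = (r·aU − u·aR)(r·bU − u·bR) + r²(u·y − aU·bU) + u(r·x − aR·bR)`.
[folklore] -/
theorem hardCoreHarris_one_algebra (a b ab u r aU aR bU bR x y : ℝ)
    (hAdec : aU + aR = a) (hBdec : bU + bR = b) (hABdec : y + x = ab) (hURdec : u + r = 1)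
    (h1 : aR * bR ≤ x * r) (h2 : a * u ≤ aU) (h3 : b * u ≤ bU) (h4 : a * b ≤ ab)
    (n_aU : 0 ≤ aU) (n_aR : 0 ≤ aR) (n_bU : 0 ≤ bU) (n_bR : 0 ≤ bR) (n_x : 0 ≤ x) (n_y : 0 ≤ y)
    (n_u : 0 ≤ u) (n_r : 0 ≤ r)
    (le_aR : aR ≤ r) (le_bR : bR ≤ r) (le_xR : x ≤ r) (le_aU : aU ≤ u) (le_bU : bU ≤ u) (le_yU : y ≤ u) :
    a * b - aU * bU ≤ ab - y * u := by
  -- Harris in the two-block form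
  have h2' : aR * u ≤ aU * r := by nlinarith [h2, hAdec, hURdec]
  have h3' : bR * u ≤ bU * r := by nlinarith [h3, hBdec, hURdec]
  by_cases hc : y * u ≤ aU * bU
  · linarith [h4]
  · have hc' : aU * bU ≤ u * y := by linarith [le_of_not_ge hc]
    have ea : a = aU + aR := hAdec.symm
    have eb : b = bU + bR := hBdec.symm
    have eab : ab = y + x := hABdec.symm
    have er : r = 1 - u := by linarith [hURdec]
    -- the identity
    have hΦ : r * u * (ab - y * u - (a * b - aU * bU)) =
        (r * aU - u * aR) * (r * bU - u * bR) + r ^ 2 * (u * y - aU * bU) + u * (r * x - aR * bR) := by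
      rw [ea, eb, eab, er]; ring
    have hpos : 0 ≤ r * u * (ab - y * u - (a * b - aU * bU)) := by
      rw [hΦ]
      have t1 : 0 ≤ (r * aU - u * aR) * (r * bU - u * bR) :=
        mul_nonneg (by linarith [h2']) (by linarith [h3'])
      have t2 : 0 ≤ r ^ 2 * (u * y - aU * bU) := mul_nonneg (sq_nonneg r) (by linarith [hc'])
      have t3 : 0 ≤ u * (r * x - aR * bR) := mul_nonneg n_u (by linarith [h1])
      linarith
    by_cases hu0 : u = 0
    · -- `U` null: `aU = bU = y = 0`, `r = 1`; the claim is BHK on `R`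
      have haU0 : aU = 0 := by linarith
      have hbU0 : bU = 0 := by linarith
      have hy0 : y = 0 := by linarith
      have hr1 : r = 1 := by linarith
      have e1 : a * b = aR * bR := by rw [ea, eb, haU0, hbU0]; ring
      have e2 : aU * bU = 0 := by rw [haU0]; ring
      have e3 : y * u = 0 := by rw [hy0]; ring
      have e4 : x * r = x := by rw [hr1]; ring
      linarith [h1]
    by_cases hr0 : r = 0
    · -- `R` null: `aR = bR = x = 0`, `u = 1`; both sides agree
      have haR0 : aR = 0 := by linarith
      have hbR0 : bR = 0 := by linarith
      have hx0 : x = 0 := by linarith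
      have hu1 : u = 1 := by linarith
      have e1 : a * b = aU * bU := by rw [ea, eb, haR0, hbR0]; ring
      have e2 : y * u = y := by rw [hu1]; ring
      have e3 : ab = y := by linarith
      linarith
    · have hru : 0 < r * u := mul_pos (lt_of_le_of_ne n_r (Ne.symm hr0)) (lt_of_le_of_ne n_u (Ne.symm hu0))
      by_contra hneg
      have hlt : ab - y * u - (a * b - aU * bU) < 0 := by linarith [lt_of_not_ge hneg]
      have : r * u * (ab - y * u - (a * b - aU * bU)) < 0 := mul_neg_of_pos_of_neg hru hlt
      linarith

/-- **Hard-core Harris, measure level, one hard-core vertex.**  For bond percolation `μ = prodBernoulli w` on a finite vertex type,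
a source set `S`, a vertex `v`, `U = {S ↔ v}` and two increasing events `A = {P(C_S)}`, `B = {Q(C_S)}` of the union cluster
`C_S = ⋃_{s ∈ S} C_s`:
`μ(A)·μ(B) − μ(A ∩ U)·μ(B ∩ U) ≤ μ(A ∩ B) − μ(A ∩ B ∩ U)·μ(U)`  (equivalently `Cov(A,B) ≥ μ(U)² Cov(A,B | U)`; equivalently, for two
independent copies, `E[1_{HC} 1_A(ω₀) 1_B(ω₁)] ≤ E[1_{HC} 1_A(ω₀) 1_B(ω₀)]` with `1_{HC} = 1 − 1_U(ω₀)1_U(ω₁)`).  From BHK's Theorem 1.3 with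
sets on `{S ↮ v}`, Harris' inequality, and the law of total covariance (module docstring).
[cite: VandenbergHaggstromKahn2005, Thm. 1.3 (p. 6) with Remark 1 after Thm. 1.2 (p. 5)] [cite: Harris1960, Lemma 4.1] -/
theorem hardCoreHarris_measure_one (w : Sym2 V → unitInterval) (S : Set V) (v : V)
    (P Q : Set (Sym2 V) → Prop) (hP : ∀ ⦃C C' : Set (Sym2 V)⦄, C ⊆ C' → P C → P C')
    (hQ : ∀ ⦃C C' : Set (Sym2 V)⦄, C ⊆ C' → Q C → Q C') :
    (prodBernoulli w).real {ω : BondConfig V | P (⋃ s ∈ S, openEdgeCluster ω s)} *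
        (prodBernoulli w).real {ω : BondConfig V | Q (⋃ s ∈ S, openEdgeCluster ω s)} -
      (prodBernoulli w).real ({ω : BondConfig V | P (⋃ s ∈ S, openEdgeCluster ω s)} ∩
          {ω | ∃ s ∈ S, (openGraph ω).Reachable s v}) *
        (prodBernoulli w).real ({ω : BondConfig V | Q (⋃ s ∈ S, openEdgeCluster ω s)} ∩
          {ω | ∃ s ∈ S, (openGraph ω).Reachable s v}) ≤
    (prodBernoulli w).real ({ω : BondConfig V | P (⋃ s ∈ S, openEdgeCluster ω s)} ∩
          {ω | Q (⋃ s ∈ S, openEdgeCluster ω s)}) -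
      (prodBernoulli w).real ({ω : BondConfig V | P (⋃ s ∈ S, openEdgeCluster ω s)} ∩
          {ω | Q (⋃ s ∈ S, openEdgeCluster ω s)} ∩ {ω | ∃ s ∈ S, (openGraph ω).Reachable s v}) *
        (prodBernoulli w).real {ω : BondConfig V | ∃ s ∈ S, (openGraph ω).Reachable s v} := by
  have hmeas : ∀ E : Set (BondConfig V), MeasurableSet E := fun _ => MeasurableSet.of_discrete
  -- `R = {S ↮ v}` is the complement of `U = {S ↔ v}`
  have hRU : {ω : BondConfig V | ∀ s ∈ S, ∀ t ∈ ({v} : Set V), ¬ (openGraph ω).Reachable s t} =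
      {ω : BondConfig V | ∃ s ∈ S, (openGraph ω).Reachable s v}ᶜ := by
    ext ω
    simp only [mem_setOf_eq, mem_singleton_iff, forall_eq, mem_compl_iff, not_exists, not_and]
  -- monotonicity: `A`, `B`, `U` are upper sets
  have hmonoC : ∀ ⦃ω ω' : BondConfig V⦄, ω ⊆ ω' →
      (⋃ s ∈ S, openEdgeCluster ω s) ⊆ (⋃ s ∈ S, openEdgeCluster ω' s) :=
    fun ω ω' hle => Set.iUnion₂_mono fun s _ => BHK2006.openEdgeCluster_mono hle s
  have hAup : IsUpperSet {ω : BondConfig V | P (⋃ s ∈ S, openEdgeCluster ω s)} :=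
    fun ω ω' hle hω => hP (hmonoC hle) hω
  have hBup : IsUpperSet {ω : BondConfig V | Q (⋃ s ∈ S, openEdgeCluster ω s)} :=
    fun ω ω' hle hω => hQ (hmonoC hle) hω
  have hUup : IsUpperSet {ω : BondConfig V | ∃ s ∈ S, (openGraph ω).Reachable s v} := by
    rintro ω ω' hle ⟨s, hs, hr⟩
    exact ⟨s, hs, hr.mono (openGraph_mono hle)⟩
  -- Harris (three times)
  have h4 := prodBernoulli_harris_via_fibres w hAup hBup
  have h2 := prodBernoulli_harris_via_fibres w hAup hUup
  have h3 := prodBernoulli_harris_via_fibres w hBup hUup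
  -- BHK Theorem 1.3 with sets on `{S ↮ v}`
  have h1 := setClusterEventExchange w S ({v} : Set V) P Q (fun _ => True) (fun _ => True) hP hQ
    (fun _ _ _ _ => trivial) (fun _ _ _ _ => trivial)
  simp only [setOf_true, inter_univ] at h1
  rw [hRU] at h1
  -- block decompositions along `U ⊔ Uᶜ`
  have hAdec := measureReal_inter_add_sdiff (μ := prodBernoulli w)
    (s := {ω : BondConfig V | P (⋃ s ∈ S, openEdgeCluster ω s)}) (hmeas {ω : BondConfig V | ∃ s ∈ S, (openGraph ω).Reachable s v})
  have hBdec := measureReal_inter_add_sdiff (μ := prodBernoulli w)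
    (s := {ω : BondConfig V | Q (⋃ s ∈ S, openEdgeCluster ω s)}) (hmeas {ω : BondConfig V | ∃ s ∈ S, (openGraph ω).Reachable s v})
  have hABdec := measureReal_inter_add_sdiff (μ := prodBernoulli w)
    (s := {ω : BondConfig V | P (⋃ s ∈ S, openEdgeCluster ω s)} ∩ {ω : BondConfig V | Q (⋃ s ∈ S, openEdgeCluster ω s)})
    (hmeas {ω : BondConfig V | ∃ s ∈ S, (openGraph ω).Reachable s v})
  have hURdec := measureReal_add_measureReal_compl (μ := prodBernoulli w)
    (hmeas {ω : BondConfig V | ∃ s ∈ S, (openGraph ω).Reachable s v})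
  rw [probReal_univ] at hURdec
  rw [Set.sdiff_eq] at hAdec hBdec hABdec
  -- rewrite the BHK blocks `Uᶜ ∩ E` as `E ∩ Uᶜ`
  rw [inter_comm ({ω : BondConfig V | ∃ s ∈ S, (openGraph ω).Reachable s v}ᶜ), inter_comm ({ω : BondConfig V | ∃ s ∈ S, (openGraph ω).Reachable s v}ᶜ),
    inter_comm ({ω : BondConfig V | ∃ s ∈ S, (openGraph ω).Reachable s v}ᶜ)] at h1
  -- the real-arithmetic core
  exact hardCoreHarris_one_algebra _ _ _ _ _ _ _ _ _ _ _ hAdec hBdec hABdec hURdec h1 h2 h3 h4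
    measureReal_nonneg measureReal_nonneg measureReal_nonneg measureReal_nonneg measureReal_nonneg measureReal_nonneg
    measureReal_nonneg measureReal_nonneg
    (measureReal_mono inter_subset_right) (measureReal_mono inter_subset_right) (measureReal_mono inter_subset_right)
    (measureReal_mono inter_subset_right) (measureReal_mono inter_subset_right) (measureReal_mono inter_subset_right)

/-- The real-arithmetic core of `twoCopyAssoc_measure_one`: from BHK on the block `R` (`fR·gR ≤ x·r`), Harris (`f·g ≤ fg`,
`fR ≤ f·r`, `gR ≤ g·r`) and the trivial bounds, `(r·f + u·fR)(r·g + u·gR) ≤ (r·fg + u·x)·(r·(1+u))`.  Key step: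
after BHK and Harris the difference is at least `u·(r·f − fR)(r·g − gR) ≥ 0`. [folklore] -/
theorem twoCopyAssoc_one_algebra (f g fg u r fR gR x : ℝ)
    (h1 : fR * gR ≤ x * r) (h4 : f * g ≤ fg) (h5 : fR ≤ f * r) (h6 : gR ≤ g * r)
    (n_u : 0 ≤ u) (n_r : 0 ≤ r) :
    (r * f + u * fR) * (r * g + u * gR) ≤ (r * fg + u * x) * (r * (1 + u)) := by
  have t1 : 0 ≤ u * ((f * r - fR) * (g * r - gR)) :=
    mul_nonneg n_u (mul_nonneg (by linarith) (by linarith))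
  have t2 : 0 ≤ (1 + u) * u * (x * r - fR * gR) := mul_nonneg (mul_nonneg (by linarith) n_u) (by linarith)
  have t3 : 0 ≤ r * r * (1 + u) * (fg - f * g) := mul_nonneg (mul_nonneg (mul_nonneg n_r n_r) (by linarith)) (by linarith)
  nlinarith [t1, t2, t3]

/-- **Two-copy positive association, measure level, one hard-core vertex.**  For bond percolation `μ = prodBernoulli w` on a finite
vertex type, a source set `S`, a vertex `v`, `U = {S ↔ v}`, `R = Uᶜ = {S ↮ v}` and two increasing events `F = {P(C_S)}`, `G = {Q(C_S)}`
of the union cluster: with `u = μ(U)`, `r = μ(R)`,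
`(r·μ(F) + u·μ(F ∩ R)) · (r·μ(G) + u·μ(G ∩ R)) ≤ (r·μ(F ∩ G) + u·μ(F ∩ G ∩ R)) · (r·(1 + u))`.
This is exactly `E[1_H 1_F(ω₀)]·E[1_H 1_G(ω₀)] ≤ E[1_H 1_F(ω₀) 1_G(ω₀)]·E[1_H]` for two independent copies `ω₀, ω₁ ~ μ` and
`1_H = 1 − 1_U(ω₀)1_U(ω₁)` (condition on `ω₁`: `1_U(ω₁) = 0` with probability `r` leaves `μ`, `= 1` with probability `u` leaves
`μ(· ∩ R)`), i.e. the cluster of copy 0 is POSITIVELY ASSOCIATED given the two-copy hard-core event at `v` — the `|N| = 1` case of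
the lead's measure-level "two-copy BHK" (a) (memo LEAD-GEN105 §1(6); general `N` by the averaging-operator iteration, pencil).
Proof: BHK's Theorem 1.3 with sets on `R` (`μ(F∩G∩R)μ(R) ≥ μ(F∩R)μ(G∩R)`), Harris (`μ(F∩G) ≥ μ(F)μ(G)`, `μ(F∩R) ≤ μ(F)μ(R)`,
`μ(G∩R) ≤ μ(G)μ(R)`), and `difference ≥ u·(rμ(F) − μ(F∩R))·(rμ(G) − μ(G∩R)) ≥ 0`.
[cite: VandenbergHaggstromKahn2005, Thm. 1.3 (p. 6) with Remark 1 after Thm. 1.2 (p. 5)] [cite: Harris1960, Lemma 4.1] -/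
theorem twoCopyAssoc_measure_one (w : Sym2 V → unitInterval) (S : Set V) (v : V)
    (P Q : Set (Sym2 V) → Prop) (hP : ∀ ⦃C C' : Set (Sym2 V)⦄, C ⊆ C' → P C → P C')
    (hQ : ∀ ⦃C C' : Set (Sym2 V)⦄, C ⊆ C' → Q C → Q C') :
    ((prodBernoulli w).real {ω : BondConfig V | ∃ s ∈ S, (openGraph ω).Reachable s v}ᶜ *
          (prodBernoulli w).real {ω : BondConfig V | P (⋃ s ∈ S, openEdgeCluster ω s)} +
        (prodBernoulli w).real {ω : BondConfig V | ∃ s ∈ S, (openGraph ω).Reachable s v} *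
          (prodBernoulli w).real ({ω : BondConfig V | P (⋃ s ∈ S, openEdgeCluster ω s)} ∩
            {ω : BondConfig V | ∃ s ∈ S, (openGraph ω).Reachable s v}ᶜ)) *
      ((prodBernoulli w).real {ω : BondConfig V | ∃ s ∈ S, (openGraph ω).Reachable s v}ᶜ *
          (prodBernoulli w).real {ω : BondConfig V | Q (⋃ s ∈ S, openEdgeCluster ω s)} +
        (prodBernoulli w).real {ω : BondConfig V | ∃ s ∈ S, (openGraph ω).Reachable s v} *
          (prodBernoulli w).real ({ω : BondConfig V | Q (⋃ s ∈ S, openEdgeCluster ω s)} ∩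
            {ω : BondConfig V | ∃ s ∈ S, (openGraph ω).Reachable s v}ᶜ)) ≤
    ((prodBernoulli w).real {ω : BondConfig V | ∃ s ∈ S, (openGraph ω).Reachable s v}ᶜ *
          (prodBernoulli w).real ({ω : BondConfig V | P (⋃ s ∈ S, openEdgeCluster ω s)} ∩
            {ω : BondConfig V | Q (⋃ s ∈ S, openEdgeCluster ω s)}) +
        (prodBernoulli w).real {ω : BondConfig V | ∃ s ∈ S, (openGraph ω).Reachable s v} *
          (prodBernoulli w).real ({ω : BondConfig V | P (⋃ s ∈ S, openEdgeCluster ω s)} ∩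
            {ω : BondConfig V | Q (⋃ s ∈ S, openEdgeCluster ω s)} ∩
            {ω : BondConfig V | ∃ s ∈ S, (openGraph ω).Reachable s v}ᶜ)) *
      ((prodBernoulli w).real {ω : BondConfig V | ∃ s ∈ S, (openGraph ω).Reachable s v}ᶜ *
        (1 + (prodBernoulli w).real {ω : BondConfig V | ∃ s ∈ S, (openGraph ω).Reachable s v})) := by
  have hmeas : ∀ E : Set (BondConfig V), MeasurableSet E := fun _ => MeasurableSet.of_discrete
  have hRU : {ω : BondConfig V | ∀ s ∈ S, ∀ t ∈ ({v} : Set V), ¬ (openGraph ω).Reachable s t} =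
      {ω : BondConfig V | ∃ s ∈ S, (openGraph ω).Reachable s v}ᶜ := by
    ext ω
    simp only [mem_setOf_eq, mem_singleton_iff, forall_eq, mem_compl_iff, not_exists, not_and]
  have hmonoC : ∀ ⦃ω ω' : BondConfig V⦄, ω ⊆ ω' →
      (⋃ s ∈ S, openEdgeCluster ω s) ⊆ (⋃ s ∈ S, openEdgeCluster ω' s) :=
    fun ω ω' hle => Set.iUnion₂_mono fun s _ => BHK2006.openEdgeCluster_mono hle s
  have hAup : IsUpperSet {ω : BondConfig V | P (⋃ s ∈ S, openEdgeCluster ω s)} :=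
    fun ω ω' hle hω => hP (hmonoC hle) hω
  have hBup : IsUpperSet {ω : BondConfig V | Q (⋃ s ∈ S, openEdgeCluster ω s)} :=
    fun ω ω' hle hω => hQ (hmonoC hle) hω
  have hUup : IsUpperSet {ω : BondConfig V | ∃ s ∈ S, (openGraph ω).Reachable s v} := by
    rintro ω ω' hle ⟨s, hs, hr⟩
    exact ⟨s, hs, hr.mono (openGraph_mono hle)⟩
  -- Harris
  have h4 := prodBernoulli_harris_via_fibres w hAup hBup
  have h2 := prodBernoulli_harris_via_fibres w hAup hUup
  have h3 := prodBernoulli_harris_via_fibres w hBup hUup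
  -- BHK Theorem 1.3 with sets on `{S ↮ v}`
  have h1 := setClusterEventExchange w S ({v} : Set V) P Q (fun _ => True) (fun _ => True) hP hQ
    (fun _ _ _ _ => trivial) (fun _ _ _ _ => trivial)
  simp only [setOf_true, inter_univ] at h1
  rw [hRU] at h1
  rw [inter_comm ({ω : BondConfig V | ∃ s ∈ S, (openGraph ω).Reachable s v}ᶜ), inter_comm ({ω : BondConfig V | ∃ s ∈ S, (openGraph ω).Reachable s v}ᶜ),
    inter_comm ({ω : BondConfig V | ∃ s ∈ S, (openGraph ω).Reachable s v}ᶜ)] at h1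
  -- block decompositions
  have hAdec := measureReal_inter_add_sdiff (μ := prodBernoulli w)
    (s := {ω : BondConfig V | P (⋃ s ∈ S, openEdgeCluster ω s)}) (hmeas {ω : BondConfig V | ∃ s ∈ S, (openGraph ω).Reachable s v})
  have hBdec := measureReal_inter_add_sdiff (μ := prodBernoulli w)
    (s := {ω : BondConfig V | Q (⋃ s ∈ S, openEdgeCluster ω s)}) (hmeas {ω : BondConfig V | ∃ s ∈ S, (openGraph ω).Reachable s v})
  have hURdec := measureReal_add_measureReal_compl (μ := prodBernoulli w)
    (hmeas {ω : BondConfig V | ∃ s ∈ S, (openGraph ω).Reachable s v})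
  rw [probReal_univ] at hURdec
  rw [Set.sdiff_eq] at hAdec hBdec
  have hr : (prodBernoulli w).real {ω : BondConfig V | ∃ s ∈ S, (openGraph ω).Reachable s v}ᶜ =
      1 - (prodBernoulli w).real {ω : BondConfig V | ∃ s ∈ S, (openGraph ω).Reachable s v} := by linarith [hURdec]
  -- Harris with the decreasing block: `μ(F ∩ R) ≤ μ(F)·μ(R)`
  have h5 : (prodBernoulli w).real ({ω : BondConfig V | P (⋃ s ∈ S, openEdgeCluster ω s)} ∩
        {ω : BondConfig V | ∃ s ∈ S, (openGraph ω).Reachable s v}ᶜ) ≤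
      (prodBernoulli w).real {ω : BondConfig V | P (⋃ s ∈ S, openEdgeCluster ω s)} *
        (prodBernoulli w).real {ω : BondConfig V | ∃ s ∈ S, (openGraph ω).Reachable s v}ᶜ := by
    rw [hr, mul_sub, mul_one]; linarith [h2, hAdec]
  have h6 : (prodBernoulli w).real ({ω : BondConfig V | Q (⋃ s ∈ S, openEdgeCluster ω s)} ∩
        {ω : BondConfig V | ∃ s ∈ S, (openGraph ω).Reachable s v}ᶜ) ≤
      (prodBernoulli w).real {ω : BondConfig V | Q (⋃ s ∈ S, openEdgeCluster ω s)} *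
        (prodBernoulli w).real {ω : BondConfig V | ∃ s ∈ S, (openGraph ω).Reachable s v}ᶜ := by
    rw [hr, mul_sub, mul_one]; linarith [h3, hBdec]
  exact twoCopyAssoc_one_algebra _ _ _ _ _ _ _ _ h1 h4 h5 h6 measureReal_nonneg measureReal_nonneg

/-- **Two-copy NEGATIVE correlation, measure level, one hard-core vertex** — the measure-level form of (G-b) at `N = {v}`: for two
independent copies and `1_H = 1 − 1_U(ω₀)1_U(ω₁)`, `E[1_H 1_F(ω₀) 1_G(ω₁)]·E[1_H] ≤ E[1_H 1_F(ω₀)]·E[1_H 1_G(ω₁)]`, i.e.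
`(μ(F)μ(G) − μ(F∩U)μ(G∩U))·(1 − μ(U)²) ≤ (μ(F) − μ(F∩U)μ(U))·(μ(G) − μ(G∩U)μ(U))` — equivalent to
`0 ≤ (μ(F)μ(U) − μ(F∩U))·(μ(G)μ(U) − μ(G∩U))`, two applications of Harris.  NOTE: the FIBREWISE (two-copy profile) version of this
negative correlation is FALSE from 6 vertices (lead gen 105 census: tree 0–4,1–4,2–5,3–5,4–5, S = {0,1}, T = {2,3}), while (HC⁺) and the
positive association (a) are census-clean fibrewise — measure level does not discriminate. [cite: Harris1960, Lemma 4.1] -/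
theorem twoCopyNegCorr_measure_one (w : Sym2 V → unitInterval) (S : Set V) (v : V)
    (P Q : Set (Sym2 V) → Prop) (hP : ∀ ⦃C C' : Set (Sym2 V)⦄, C ⊆ C' → P C → P C')
    (hQ : ∀ ⦃C C' : Set (Sym2 V)⦄, C ⊆ C' → Q C → Q C') :
    ((prodBernoulli w).real {ω : BondConfig V | P (⋃ s ∈ S, openEdgeCluster ω s)} *
          (prodBernoulli w).real {ω : BondConfig V | Q (⋃ s ∈ S, openEdgeCluster ω s)} -
        (prodBernoulli w).real ({ω : BondConfig V | P (⋃ s ∈ S, openEdgeCluster ω s)} ∩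
            {ω | ∃ s ∈ S, (openGraph ω).Reachable s v}) *
          (prodBernoulli w).real ({ω : BondConfig V | Q (⋃ s ∈ S, openEdgeCluster ω s)} ∩
            {ω | ∃ s ∈ S, (openGraph ω).Reachable s v})) *
      (1 - (prodBernoulli w).real {ω : BondConfig V | ∃ s ∈ S, (openGraph ω).Reachable s v} ^ 2) ≤
    ((prodBernoulli w).real {ω : BondConfig V | P (⋃ s ∈ S, openEdgeCluster ω s)} -
        (prodBernoulli w).real ({ω : BondConfig V | P (⋃ s ∈ S, openEdgeCluster ω s)} ∩
            {ω | ∃ s ∈ S, (openGraph ω).Reachable s v}) *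
          (prodBernoulli w).real {ω : BondConfig V | ∃ s ∈ S, (openGraph ω).Reachable s v}) *
      ((prodBernoulli w).real {ω : BondConfig V | Q (⋃ s ∈ S, openEdgeCluster ω s)} -
        (prodBernoulli w).real ({ω : BondConfig V | Q (⋃ s ∈ S, openEdgeCluster ω s)} ∩
            {ω | ∃ s ∈ S, (openGraph ω).Reachable s v}) *
          (prodBernoulli w).real {ω : BondConfig V | ∃ s ∈ S, (openGraph ω).Reachable s v}) := by
  have hmonoC : ∀ ⦃ω ω' : BondConfig V⦄, ω ⊆ ω' →
      (⋃ s ∈ S, openEdgeCluster ω s) ⊆ (⋃ s ∈ S, openEdgeCluster ω' s) :=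
    fun ω ω' hle => Set.iUnion₂_mono fun s _ => BHK2006.openEdgeCluster_mono hle s
  have hAup : IsUpperSet {ω : BondConfig V | P (⋃ s ∈ S, openEdgeCluster ω s)} :=
    fun ω ω' hle hω => hP (hmonoC hle) hω
  have hBup : IsUpperSet {ω : BondConfig V | Q (⋃ s ∈ S, openEdgeCluster ω s)} :=
    fun ω ω' hle hω => hQ (hmonoC hle) hω
  have hUup : IsUpperSet {ω : BondConfig V | ∃ s ∈ S, (openGraph ω).Reachable s v} := by
    rintro ω ω' hle ⟨s, hs, hr⟩
    exact ⟨s, hs, hr.mono (openGraph_mono hle)⟩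
  have h2 := prodBernoulli_harris_via_fibres w hAup hUup
  have h3 := prodBernoulli_harris_via_fibres w hBup hUup
  -- `0 ≤ (f u − fU)(g u − gU)` with both factors ≤ 0, and RHS − LHS equals that product
  have key : 0 ≤ ((prodBernoulli w).real {ω : BondConfig V | P (⋃ s ∈ S, openEdgeCluster ω s)} *
        (prodBernoulli w).real {ω : BondConfig V | ∃ s ∈ S, (openGraph ω).Reachable s v} -
      (prodBernoulli w).real ({ω : BondConfig V | P (⋃ s ∈ S, openEdgeCluster ω s)} ∩
        {ω | ∃ s ∈ S, (openGraph ω).Reachable s v})) *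
      ((prodBernoulli w).real {ω : BondConfig V | Q (⋃ s ∈ S, openEdgeCluster ω s)} *
        (prodBernoulli w).real {ω : BondConfig V | ∃ s ∈ S, (openGraph ω).Reachable s v} -
      (prodBernoulli w).real ({ω : BondConfig V | Q (⋃ s ∈ S, openEdgeCluster ω s)} ∩
        {ω | ∃ s ∈ S, (openGraph ω).Reachable s v})) :=
    mul_nonneg_of_nonpos_of_nonpos (by linarith) (by linarith)
  nlinarith [key]

end Consts

end Summit.CriticalPhenomena.PercolationContinuityZ3.Theorems
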